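import Mathlib.Analysis.InnerProductSpace.PiL2
import Mathlib.Analysis.SpecialFunctions.Pow.Real
import HarnessLib

/-!
# Cutoff propagators are Gram matrices (finite form of BGM 2003 (3.50a)–(3.52))

Topic `Literature/MathematicalPhysics/QuantumLattice`.  The input of the Gram–Hadamard / tree
expansion bounds (`FermionicTreeExpansionBounds/Trees/Decay.lean`: propagators in GRAM FORM
`G f f' = ⟪α_f, β_{f'}⟫` with controlled norms) for a propagator with a nonnegative momentum cutoff.
Benfatto–Giuliani–Mastropietro 2003, §3 after (3.50): "Let `ℋ = ℝ^{|O_h|} ⊗ ℝ^s ⊗ L²(ℝ³)`; it can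
be shown that `G^{h,T}_{ij,i'j'} = ⟨v_{ω⁻} ⊗ u_i ⊗ A_{x,ω⁻}, v_{ω⁺} ⊗ u_{i'} ⊗ B_{y,ω⁺}⟩`" with
(3.52) `A_{x,ω}(k) = e^{ikx} √F_{h,ω}(k) / (k₀² + (ε(k)-μ)²)`, `B_{x,ω}(k) = e^{ikx} √F_{h,ω}(k) (ik₀ + ε(k) - μ)`,
"with `‖A‖·‖B‖` satisfying the same dimensional bound as" the propagator.  Here, for a FINITE
momentum set `K` (finite volume and finitely many Matsubara frequencies in the support of a
single-scale cutoff, or any Riemann sum), unimodular plane waves `χ κ x`, a cutoff `F ≥ 0` and a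
symbol `D` (e.g. `D = ik₀ + ε - μ`; momenta with `D = 0` are harmless: all three sides vanish
there), we PROVE, in the symmetric normalisation `√F/√|D|`, `√F√|D|/D`:

* `gramA`, `gramB` — the Gram vectors in `EuclideanSpace ℂ K`;
* `inner_gramA_gramB` — `⟪A_x, B_y⟫ = Σ_κ conj(χ_κ(x)) χ_κ(y) F(κ)/D(κ)` (the cutoff propagator
  from `x` to `y`);
* `norm_sq_gramA`, `norm_sq_gramB` — `‖A_x‖² = ‖B_y‖² = Σ_κ F(κ)/|D(κ)|`, so that
  `|g(x,y)| ≤ ‖A_x‖ ‖B_y‖ = Σ_κ F/|D|` uniformly in `x, y` (`norm_inner_gramA_gramB_le`);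
* `deltaVec` — the Kronecker tensor `v_o ⊗ w` in `EuclideanSpace ℂ (O × K)` attaching an internal
  index (sector, spin) with `⟪v_o ⊗ w, v_{o'} ⊗ w'⟫ = δ_{o,o'} ⟪w, w'⟫` and `‖v_o ⊗ w‖ = ‖w‖`
  (`inner_deltaVec`, `norm_deltaVec`) — the `δ_{ω⁻_l,ω⁺_l} δ_{σ⁻_l,σ⁺_l}` of BGM 2006 (2.66).

Everything is PROVED; the definitions are the three vectors. [cite: BenfattoGiulianiMastropietro2003, §3 (3.50a)-(3.52)]

## Sources

* G. Benfatto, A. Giuliani, V. Mastropietro, Ann. Henri Poincaré 4 (2003) 137–193, §3,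
  (3.50)–(3.52) (arXiv:cond-mat/0207210 p. 14). [BenfattoGiulianiMastropietro2003]
* G. Benfatto, A. Giuliani, V. Mastropietro, Ann. Henri Poincaré 7 (2006) 809–898, (2.66)–(2.67a)
  and (2.80). [BenfattoGiulianiMastropietro2006]
-/

noncomputable section

open Finset
open scoped InnerProductSpace ComplexConjugate

namespace Literature.MathematicalPhysics.QuantumLattice

namespace CutoffGram

variable {K : Type*} [Fintype K] {X : Type*}
variable (χ : K → X → ℂ) (F : K → ℝ) (D : K → ℂ)

/-- The Gram vector `A_x(κ) = χ_κ(x) √F(κ)/√|D(κ)|`. [cite: BenfattoGiulianiMastropietro2003, §3 (3.52)] -/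
def gramA (x : X) : EuclideanSpace ℂ K :=
  WithLp.toLp 2 fun κ => χ κ x * ((Real.sqrt (F κ) / Real.sqrt ‖D κ‖ : ℝ) : ℂ)

/-- The Gram vector `B_y(κ) = χ_κ(y) √F(κ)√|D(κ)| / D(κ)`. [cite: BenfattoGiulianiMastropietro2003, §3 (3.52)] -/
def gramB (y : X) : EuclideanSpace ℂ K :=
  WithLp.toLp 2 fun κ => χ κ y * (((Real.sqrt (F κ) * Real.sqrt ‖D κ‖ : ℝ) : ℂ) / D κ)

variable {χ F D}

omit [Fintype K] in
/-- The scalar identity behind the Gram form: `(√F/√|D|) · (√F√|D|/D) = F/D` (both sides `0` when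
`D = 0`). [folklore] -/
theorem sqrt_div_mul_sqrt_mul_div (hF : ∀ κ, 0 ≤ F κ) (κ : K) :
    ((Real.sqrt (F κ) / Real.sqrt ‖D κ‖ : ℝ) : ℂ) * (((Real.sqrt (F κ) * Real.sqrt ‖D κ‖ : ℝ) : ℂ) / D κ) =
      (F κ : ℂ) / D κ := by
  by_cases hD : D κ = 0
  · simp [hD]
  · have hn : 0 < ‖D κ‖ := norm_pos_iff.2 hD
    have hs : Real.sqrt ‖D κ‖ ≠ 0 := (Real.sqrt_pos.2 hn).ne'
    have key : Real.sqrt (F κ) / Real.sqrt ‖D κ‖ * (Real.sqrt (F κ) * Real.sqrt ‖D κ‖) = F κ := by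
      rw [div_mul_eq_mul_div, ← mul_assoc, mul_div_assoc, div_self hs, mul_one, Real.mul_self_sqrt (hF κ)]
    calc ((Real.sqrt (F κ) / Real.sqrt ‖D κ‖ : ℝ) : ℂ) * (((Real.sqrt (F κ) * Real.sqrt ‖D κ‖ : ℝ) : ℂ) / D κ)
        = ((Real.sqrt (F κ) / Real.sqrt ‖D κ‖ * (Real.sqrt (F κ) * Real.sqrt ‖D κ‖) : ℝ) : ℂ) / D κ := by
          push_cast; ring
      _ = (F κ : ℂ) / D κ := by rw [key]

/-- **The cutoff propagator is a Gram matrix**: `⟪A_x, B_y⟫ = Σ_κ conj(χ_κ(x)) χ_κ(y) F(κ)/D(κ)`. [cite: BenfattoGiulianiMastropietro2003, §3 (3.50a)-(3.52)] -/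
theorem inner_gramA_gramB (hF : ∀ κ, 0 ≤ F κ) (x y : X) :
    ⟪gramA χ F D x, gramB χ F D y⟫_ℂ = ∑ κ, conj (χ κ x) * χ κ y * ((F κ : ℂ) / D κ) := by
  simp only [gramA, gramB, PiLp.inner_apply, RCLike.inner_apply]
  refine sum_congr rfl fun κ _ => ?_
  rw [← sqrt_div_mul_sqrt_mul_div hF κ, map_mul, Complex.conj_ofReal]
  ring

/-- `‖A_x‖² = Σ_κ F(κ)/|D(κ)|` for unimodular plane waves. [cite: BenfattoGiulianiMastropietro2003, §3 (3.52)] -/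
theorem norm_sq_gramA (hχ : ∀ κ x, ‖χ κ x‖ = 1) (hF : ∀ κ, 0 ≤ F κ) (x : X) :
    ‖gramA χ F D x‖ ^ 2 = ∑ κ, F κ / ‖D κ‖ := by
  rw [EuclideanSpace.norm_eq, Real.sq_sqrt (sum_nonneg fun κ _ => by positivity)]
  refine sum_congr rfl fun κ _ => ?_
  simp only [gramA, WithLp.ofLp_toLp, norm_mul, hχ, one_mul, Complex.norm_real, Real.norm_eq_abs]
  rw [sq_abs, div_pow, Real.sq_sqrt (hF κ), Real.sq_sqrt (norm_nonneg _)]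

/-- `‖B_y‖² = Σ_κ F(κ)/|D(κ)|` for unimodular plane waves. [cite: BenfattoGiulianiMastropietro2003, §3 (3.52)] -/
theorem norm_sq_gramB (hχ : ∀ κ x, ‖χ κ x‖ = 1) (hF : ∀ κ, 0 ≤ F κ) (y : X) :
    ‖gramB χ F D y‖ ^ 2 = ∑ κ, F κ / ‖D κ‖ := by
  rw [EuclideanSpace.norm_eq, Real.sq_sqrt (sum_nonneg fun κ _ => by positivity)]
  refine sum_congr rfl fun κ _ => ?_
  simp only [gramB, WithLp.ofLp_toLp, norm_mul, norm_div, hχ, one_mul, Complex.norm_real,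
    Real.norm_eq_abs, abs_of_nonneg (Real.sqrt_nonneg _)]
  by_cases hD : D κ = 0
  · simp [hD]
  · have hn : 0 < ‖D κ‖ := norm_pos_iff.2 hD
    rw [div_pow, mul_pow, Real.sq_sqrt (hF κ), Real.sq_sqrt hn.le]
    field_simp

/-- **Dimensional bound of the cutoff propagator**: `|⟪A_x, B_y⟫| ≤ Σ_κ F(κ)/|D(κ)|` uniformly in
`x, y` (Cauchy–Schwarz with `norm_sq_gramA/B`; this is the `‖A‖·‖B‖` of the Gram–Hadamard bound
BGM 2003 (3.50)). [cite: BenfattoGiulianiMastropietro2003, §3 (3.50)-(3.52)] -/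
theorem norm_inner_gramA_gramB_le (hχ : ∀ κ x, ‖χ κ x‖ = 1) (hF : ∀ κ, 0 ≤ F κ) (x y : X) :
    ‖⟪gramA χ F D x, gramB χ F D y⟫_ℂ‖ ≤ ∑ κ, F κ / ‖D κ‖ := by
  have hA := norm_sq_gramA (D := D) hχ hF x
  have hB := norm_sq_gramB (D := D) hχ hF y
  have hS : 0 ≤ ∑ κ, F κ / ‖D κ‖ := sum_nonneg fun κ _ => div_nonneg (hF κ) (norm_nonneg _)
  have hAn : ‖gramA χ F D x‖ = Real.sqrt (∑ κ, F κ / ‖D κ‖) := by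
    rw [← hA, Real.sqrt_sq (norm_nonneg _)]
  have hBn : ‖gramB χ F D y‖ = Real.sqrt (∑ κ, F κ / ‖D κ‖) := by
    rw [← hB, Real.sqrt_sq (norm_nonneg _)]
  calc ‖⟪gramA χ F D x, gramB χ F D y⟫_ℂ‖ ≤ ‖gramA χ F D x‖ * ‖gramB χ F D y‖ := norm_inner_le_norm _ _
    _ = ∑ κ, F κ / ‖D κ‖ := by rw [hAn, hBn, Real.mul_self_sqrt hS]

/-! ### Kronecker deltas in the internal indices -/

variable {O : Type*} [Fintype O] [DecidableEq O]

/-- The Kronecker tensor `v_o ⊗ w ∈ ℂ^{O × K}`: `(o', κ) ↦ δ_{o,o'} w(κ)`. [cite: BenfattoGiulianiMastropietro2003, §3 (3.50a)] -/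
def deltaVec (o : O) (w : EuclideanSpace ℂ K) : EuclideanSpace ℂ (O × K) :=
  WithLp.toLp 2 fun p => if p.1 = o then w p.2 else 0

/-- `⟪v_o ⊗ w, v_{o'} ⊗ w'⟫ = δ_{o,o'} ⟪w, w'⟫`. [cite: BenfattoGiulianiMastropietro2003, §3 (3.50a)] -/
theorem inner_deltaVec (o o' : O) (w w' : EuclideanSpace ℂ K) :
    ⟪deltaVec o w, deltaVec o' w'⟫_ℂ = if o = o' then ⟪w, w'⟫_ℂ else 0 := by
  simp only [deltaVec, PiLp.inner_apply, RCLike.inner_apply]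
  rw [Fintype.sum_prod_type]
  split_ifs with h
  · subst h
    rw [Finset.sum_eq_single o (fun o'' _ hne => by simp [hne]) (fun h => absurd (mem_univ o) h)]
    simp
  · refine sum_eq_zero fun o'' _ => sum_eq_zero fun κ _ => ?_
    by_cases h1 : o'' = o
    · subst h1; simp [h]
    · simp [h1]

/-- `‖v_o ⊗ w‖ = ‖w‖`. [cite: BenfattoGiulianiMastropietro2003, §3 (3.50a)] -/
theorem norm_deltaVec (o : O) (w : EuclideanSpace ℂ K) : ‖deltaVec o w‖ = ‖w‖ := by
  have h := inner_deltaVec o o w w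
  rw [if_pos rfl] at h
  have h1 : (‖deltaVec o w‖ : ℝ) ^ 2 = ‖w‖ ^ 2 := by
    have := congrArg RCLike.re h
    rwa [inner_self_eq_norm_sq (𝕜 := ℂ), inner_self_eq_norm_sq (𝕜 := ℂ)] at this
  exact (sq_eq_sq₀ (norm_nonneg _) (norm_nonneg _)).1 h1

/-- **The propagator with Kronecker deltas in the internal indices is a Gram matrix**:
`⟪v_o ⊗ A_x, v_{o'} ⊗ B_y⟫ = δ_{o,o'} Σ_κ conj(χ_κ(x)) χ_κ(y) F/D`, with
`‖v_o ⊗ A_x‖² = ‖v_{o'} ⊗ B_y‖² = Σ_κ F/|D|` — the form consumed by the tree-expansion bounds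
(one Gram family per internal index, e.g. the sector and spin of the field). [cite: BenfattoGiulianiMastropietro2003, §3 (3.50a)-(3.52)] -/
theorem inner_deltaVec_gramA_gramB (hF : ∀ κ, 0 ≤ F κ) (o o' : O) (x y : X) :
    ⟪deltaVec o (gramA χ F D x), deltaVec o' (gramB χ F D y)⟫_ℂ =
      if o = o' then ∑ κ, conj (χ κ x) * χ κ y * ((F κ : ℂ) / D κ) else 0 := by
  rw [inner_deltaVec, inner_gramA_gramB hF]

end CutoffGram

end Literature.MathematicalPhysics.QuantumLattice

end
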